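import Mathlib
import HarnessLib

/-!
# Zhang's weighted Laplacian comparison for the distance on a gradient shrinker, along geodesic
# directions (Zhang 2009, Prop. 2.2 (ii)), part 1: the cut-off and the real-variable integral bound

Towards the discharge of the named fact `shrinkerScalarCurvature_nonneg` (Zhang 2009, Thm. 1.3 (ii):
complete gradient shrinkers have `R ≥ 0`), whose geometric half is the weighted Laplacian comparison
for `d(p, ·)` along geodesic directions in second-variation / upper-barrier form (parts 2–3). This
file is the model-free part: a uniform bound for `χ'`, `χ = Real.smoothTransition`
(`exists_bound_deriv_smoothTransition`); the cut-off profile `φ_T(t) = χ(t) χ(2T + 1 − 2t)` as an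
EXISTENCE statement (`exists_cutoff`: `φ_T(0) = 0`, `φ_T = 1` on `[1, T]`, `φ_T = 0` for `t ≤ 0` and
`t ≥ T + ½`, `|φ_T'| ≤ 3 sup|χ'|`, `φ_T' = 0` on `[1, T]`; no definition is introduced); and the
one-variable heart of the comparison, `cutoff_integral_bound`:
`∫₀ᵀ (−φ²(½ − F₂) + c φ'²) − F₁(T) ≤ c(3K)² + 6KG` whenever `F₁' = F₂`, `|F₁| ≤ G` on `[0, 1]` —
one integration by parts whose boundary term `F₁(T)` is exactly the drift term `df(γ̇(T))` of the
weighted Laplacian (the Wei–Wylie cancellation). Parts 2–3 (`…Datum.lean`, `….lean`) feed it with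
`F₁ = (f∘γ)'`, `F₂ = Hess f(γ̇,γ̇) = ½ − Ric(γ̇,γ̇)` along a minimizing geodesic.

## References

* Z.-H. Zhang, *On the completeness of gradient Ricci solitons*, Proc. AMS 137 (2009) 2755–2759,
  Prop. 2.2 (ii) and proof of Thm. 1.3, Step 1. [Zhang2009]
* G. Wei, W. Wylie, *Comparison geometry for the Bakry–Émery Ricci tensor*, J. Differential Geom.
  83 (2009) 377–405, Thm. 1.1 (a).
-/

noncomputable section


open Set Function Filter MeasureTheory
open scoped ContDiff Topology ENNReal NNReal

namespace Literature.Geometry.Riemannian.Zhang2009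

/-! ### §0 The cut-off profile `χ = Real.smoothTransition` and `φ_T(t) = χ(t) χ(2T + 1 − 2t)` -/

section Cutoff

/-- A uniform bound for the derivative of `Real.smoothTransition`: it is continuous, and vanishes
off `[0, 1]` where the function is locally constant. [folklore] -/
theorem exists_bound_deriv_smoothTransition :
    ∃ K : ℝ, 0 ≤ K ∧ ∀ t : ℝ, |deriv Real.smoothTransition t| ≤ K := by
  have hcd : ContDiff ℝ 1 Real.smoothTransition :=
    (Real.smoothTransition.contDiff (n := ⊤)).of_le (by exact_mod_cast le_top)
  have hcont : Continuous (deriv Real.smoothTransition) := hcd.continuous_deriv le_rfl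
  obtain ⟨K, hK⟩ := isCompact_Icc.exists_bound_of_continuousOn (s := Icc (0 : ℝ) 1)
    hcont.continuousOn
  refine ⟨max K 0, le_max_right _ _, fun t ↦ ?_⟩
  by_cases ht : t ∈ Icc (0 : ℝ) 1
  · exact ((Real.norm_eq_abs _).symm.le.trans (hK t ht)).trans (le_max_left _ _)
  · -- off `[0, 1]` the function is locally constant, so the derivative vanishes
    have hzero : deriv Real.smoothTransition t = 0 := by
      rcases not_and_or.1 ht with h0 | h1
      · have hlt : t < 0 := lt_of_not_ge h0
        have hev : Real.smoothTransition =ᶠ[𝓝 t] fun _ ↦ (0 : ℝ) := by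
          filter_upwards [(isOpen_gt' (0 : ℝ)).mem_nhds hlt] with s hs
          exact Real.smoothTransition.zero_of_nonpos (le_of_lt hs)
        rw [hev.deriv_eq]
        simp
      · have hgt : 1 < t := lt_of_not_ge h1
        have hev : Real.smoothTransition =ᶠ[𝓝 t] fun _ ↦ (1 : ℝ) := by
          filter_upwards [(isOpen_lt' (1 : ℝ)).mem_nhds hgt] with s hs
          exact Real.smoothTransition.one_of_one_le (le_of_lt hs)
        rw [hev.deriv_eq]
        simp
    rw [hzero, abs_zero]
    exact le_max_right _ _

/-- **The cut-off along the geodesic** `φ_T(t) = χ(t) · χ(2T + 1 − 2t)`, `χ = Real.smoothTransition`,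
packaged as an existence statement (no definition is introduced): for `T ≥ 1` and a bound `K` of
`|χ'|` there is a smooth `φ : ℝ → [0, 1]` with `φ = 0` on `(-∞, 0]` and on `[T + ½, ∞)`, `φ = 1` on
`[1, T]`, `|φ'| ≤ 3K` everywhere, and `φ' = 0` on `[1, T]` (when `1 < T`; the derivative is
continuous and vanishes on the open interval, where `φ` is locally constant). [folklore] -/
theorem exists_cutoff {K : ℝ} (hK : ∀ t : ℝ, |deriv Real.smoothTransition t| ≤ K) (T : ℝ) :
    ∃ φ : ℝ → ℝ, ContDiff ℝ ∞ φ ∧ (∀ t, 0 ≤ φ t) ∧ (∀ t, φ t ≤ 1) ∧ (∀ t, t ≤ 0 → φ t = 0) ∧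
      (∀ t, T + 1 / 2 ≤ t → φ t = 0) ∧ (∀ t, 1 ≤ t → t ≤ T → φ t = 1) ∧
      (∀ t, |deriv φ t| ≤ 3 * K) ∧ (∀ t ∈ Icc (1 : ℝ) T, 1 < T → deriv φ t = 0) := by
  set φ : ℝ → ℝ := fun t ↦ Real.smoothTransition t * Real.smoothTransition (2 * T + 1 - 2 * t)
    with hφ_def
  have hφs : ContDiff ℝ ∞ φ := by
    have h1 : ContDiff ℝ ∞ Real.smoothTransition := Real.smoothTransition.contDiff
    have h2 : ContDiff ℝ ∞ (fun t : ℝ ↦ 2 * T + 1 - 2 * t) :=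
      (contDiff_const.sub (contDiff_const.mul contDiff_id))
    exact h1.mul (h1.comp h2)
  have hnonneg : ∀ t, 0 ≤ φ t := fun t ↦
    mul_nonneg (Real.smoothTransition.nonneg _) (Real.smoothTransition.nonneg _)
  have hle : ∀ t, φ t ≤ 1 := fun t ↦ by
    show Real.smoothTransition t * Real.smoothTransition (2 * T + 1 - 2 * t) ≤ 1
    calc Real.smoothTransition t * Real.smoothTransition (2 * T + 1 - 2 * t)
        ≤ 1 * 1 := mul_le_mul (Real.smoothTransition.le_one _) (Real.smoothTransition.le_one _)
          (Real.smoothTransition.nonneg _) zero_le_one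
      _ = 1 := one_mul _
  have hneg : ∀ t, t ≤ 0 → φ t = 0 := fun t ht ↦ by
    simp [hφ_def, Real.smoothTransition.zero_of_nonpos ht]
  have hge : ∀ t, T + 1 / 2 ≤ t → φ t = 0 := fun t ht ↦ by
    have h : 2 * T + 1 - 2 * t ≤ 0 := by linarith
    simp [hφ_def, Real.smoothTransition.zero_of_nonpos h]
  have hone : ∀ t, 1 ≤ t → t ≤ T → φ t = 1 := fun t h1 h2 ↦ by
    have h : 1 ≤ 2 * T + 1 - 2 * t := by linarith
    simp [hφ_def, Real.smoothTransition.one_of_one_le h1, Real.smoothTransition.one_of_one_le h]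
  -- the derivative by the product and chain rules
  have hderiv : ∀ t, HasDerivAt φ (deriv Real.smoothTransition t *
      Real.smoothTransition (2 * T + 1 - 2 * t) + Real.smoothTransition t *
        (deriv Real.smoothTransition (2 * T + 1 - 2 * t) * (-2))) t := by
    intro t
    have hd : ∀ s, HasDerivAt Real.smoothTransition (deriv Real.smoothTransition s) s := fun s ↦
      ((Real.smoothTransition.contDiffAt (n := 1)).differentiableAt one_ne_zero).hasDerivAt
    have hlin : HasDerivAt (fun t : ℝ ↦ 2 * T + 1 - 2 * t) (-2) t := by
      simpa using ((hasDerivAt_id t).const_mul (2 : ℝ)).const_sub (2 * T + 1)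
    have hcomp := (hd (2 * T + 1 - 2 * t)).comp t hlin
    exact (hd t).mul hcomp
  have hbound : ∀ t, |deriv φ t| ≤ 3 * K := by
    intro t
    rw [(hderiv t).deriv]
    have h1 := hK t
    have h2 := hK (2 * T + 1 - 2 * t)
    have a1 : |Real.smoothTransition (2 * T + 1 - 2 * t)| ≤ 1 := by
      rw [abs_of_nonneg (Real.smoothTransition.nonneg _)]; exact Real.smoothTransition.le_one _
    have a2 : |Real.smoothTransition t| ≤ 1 := by
      rw [abs_of_nonneg (Real.smoothTransition.nonneg _)]; exact Real.smoothTransition.le_one _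
    have hK0 : 0 ≤ K := (abs_nonneg _).trans h1
    calc |deriv Real.smoothTransition t * Real.smoothTransition (2 * T + 1 - 2 * t) +
          Real.smoothTransition t * (deriv Real.smoothTransition (2 * T + 1 - 2 * t) * (-2))|
        ≤ |deriv Real.smoothTransition t * Real.smoothTransition (2 * T + 1 - 2 * t)| +
          |Real.smoothTransition t * (deriv Real.smoothTransition (2 * T + 1 - 2 * t) * (-2))| :=
          abs_add_le _ _
      _ = |deriv Real.smoothTransition t| * |Real.smoothTransition (2 * T + 1 - 2 * t)| +
          |Real.smoothTransition t| * (|deriv Real.smoothTransition (2 * T + 1 - 2 * t)| * 2) := by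
          rw [abs_mul, abs_mul, abs_mul]
          norm_num
      _ ≤ K * 1 + 1 * (K * 2) := by gcongr
      _ = 3 * K := by ring
  have hflat : ∀ t ∈ Icc (1 : ℝ) T, 1 < T → deriv φ t = 0 := by
    intro t ht hT
    have hopen : ∀ s ∈ Ioo 1 T, deriv φ s = 0 := by
      intro s hs
      have hev : φ =ᶠ[𝓝 s] fun _ ↦ (1 : ℝ) := by
        filter_upwards [Ioo_mem_nhds hs.1 hs.2] with r hr
        exact hone r hr.1.le hr.2.le
      rw [hev.deriv_eq]
      simp
    have hcont : Continuous (deriv φ) := hφs.continuous_deriv (by exact_mod_cast le_top)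
    have hcl : t ∈ closure (Ioo 1 T) := by
      rw [closure_Ioo hT.ne]
      exact ht
    have hopen' : EqOn (deriv φ) (fun _ ↦ (0 : ℝ)) (Ioo 1 T) := fun s hs ↦ hopen s hs
    exact (hopen'.closure hcont continuous_const) hcl
  exact ⟨φ, hφs, hnonneg, hle, hneg, hge, hone, hbound, hflat⟩

end Cutoff


/-- **The real-variable heart of the comparison**: for a cut-off `φ` (`|φ| ≤ 1`, `|φ'| ≤ 3K`,
`φ(0) = 0`, `φ(T) = 1`, `φ' = 0` on `[1, T]`) and `F₁' = F₂` with `|F₁| ≤ G` on `[0, 1]`,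
`∫₀ᵀ (−φ²(½ − F₂) + c φ'²) − F₁(T) ≤ c(3K)² + 6KG` — one integration by parts
(`∫ φ²F₂ = F₁(T) − ∫ 2φφ'F₁`: the boundary term cancels `F₁(T)`), then pointwise bounds on
`[0, 1]` and `φ' = 0` on `[1, T]`. [folklore] -/
theorem cutoff_integral_bound {T K G c : ℝ} (hT : 1 ≤ T) (hc : 0 ≤ c)
    {φ F₁ F₂ : ℝ → ℝ} (hφd : ∀ t, DifferentiableAt ℝ φ t) (hφc : Continuous φ)
    (hφ'c : Continuous (deriv φ)) (hF₁c : Continuous F₁) (hF₂c : Continuous F₂)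
    (hF₁d : ∀ t, HasDerivAt F₁ (F₂ t) t)
    (hφabs : ∀ t, |φ t| ≤ 1) (hφ'b : ∀ t, |deriv φ t| ≤ 3 * K)
    (hφ'0 : ∀ t ∈ Icc (1 : ℝ) T, 1 < T → deriv φ t = 0) (hφ0 : φ 0 = 0) (hφT : φ T = 1)
    (hG : ∀ t ∈ Icc (0 : ℝ) 1, |F₁ t| ≤ G) :
    (∫ t in (0 : ℝ)..T, (-(φ t ^ 2 * (1 / 2 - F₂ t)) + c * deriv φ t ^ 2)) - F₁ T ≤
      c * (3 * K) ^ 2 + 6 * K * G := by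
  have hTpos : 0 < T := by linarith
  -- integration by parts: `∫ φ² F'' = F'(T) - ∫ 2φφ' F'`
  have hparts : ∫ t in (0 : ℝ)..T, φ t ^ 2 * F₂ t =
      F₁ T - ∫ t in (0 : ℝ)..T, 2 * φ t * deriv φ t * F₁ t := by
    have h := intervalIntegral.integral_mul_deriv_eq_deriv_mul (a := (0 : ℝ)) (b := T)
      (u := fun t ↦ φ t ^ 2) (u' := fun t ↦ 2 * φ t * deriv φ t) (v := F₁) (v' := F₂)
      (fun t _ ↦ by
        have h := (hφd t).hasDerivAt
        have hm := h.mul h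
        have hfun : (φ * φ) = fun y ↦ φ y ^ 2 := funext fun y ↦ by simp [sq]
        rw [hfun] at hm
        convert hm using 1
        ring)
      (fun t _ ↦ hF₁d t)
      (((continuous_const.mul hφc).mul hφ'c).intervalIntegrable _ _) (hF₂c.intervalIntegrable _ _)
    rw [h, hφT, hφ0]
    have : ∫ t in (0 : ℝ)..T, 2 * φ t * deriv φ t * F₁ t =
        ∫ t in (0 : ℝ)..T, (fun t ↦ 2 * φ t * deriv φ t) t * F₁ t := rfl
    rw [this]
    ring
  -- the combined integrand
  set w₂ : ℝ → ℝ := fun t ↦ c * deriv φ t ^ 2 - 2 * φ t * deriv φ t * F₁ t - 1 / 2 * φ t ^ 2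
    with hw₂_def
  have hw₂c : Continuous w₂ := by
    have : Continuous fun t ↦ c * deriv φ t ^ 2 - 2 * φ t * deriv φ t * F₁ t - 1 / 2 * φ t ^ 2 := by
      fun_prop
    exact this
  have hAi : IntervalIntegrable (fun t ↦ φ t ^ 2 * F₂ t) volume 0 T :=
    ((hφc.pow 2).mul hF₂c).intervalIntegrable _ _
  have hBi : IntervalIntegrable (fun t ↦ c * deriv φ t ^ 2 - 1 / 2 * φ t ^ 2) volume 0 T :=
    (by fun_prop : Continuous fun t ↦ c * deriv φ t ^ 2 - 1 / 2 * φ t ^ 2).intervalIntegrable _ _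
  have hCi : IntervalIntegrable (fun t ↦ 2 * φ t * deriv φ t * F₁ t) volume 0 T :=
    (by fun_prop : Continuous fun t ↦ 2 * φ t * deriv φ t * F₁ t).intervalIntegrable _ _
  have hkey : (∫ t in (0 : ℝ)..T, (-(φ t ^ 2 * (1 / 2 - F₂ t)) + c * deriv φ t ^ 2)) - F₁ T =
      ∫ t in (0 : ℝ)..T, w₂ t := by
    have e1 : ∫ t in (0 : ℝ)..T, (-(φ t ^ 2 * (1 / 2 - F₂ t)) + c * deriv φ t ^ 2) =
        ∫ t in (0 : ℝ)..T, (φ t ^ 2 * F₂ t + (c * deriv φ t ^ 2 - 1 / 2 * φ t ^ 2)) :=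
      intervalIntegral.integral_congr fun t _ ↦ by ring
    have e2 : ∫ t in (0 : ℝ)..T, w₂ t =
        ∫ t in (0 : ℝ)..T, ((c * deriv φ t ^ 2 - 1 / 2 * φ t ^ 2) - 2 * φ t * deriv φ t * F₁ t) :=
      intervalIntegral.integral_congr fun t _ ↦ by simp only [hw₂_def]; ring
    rw [e1, intervalIntegral.integral_add hAi hBi, e2, intervalIntegral.integral_sub hBi hCi, hparts]
    ring
  -- pointwise bounds
  set C₀ : ℝ := c * (3 * K) ^ 2 + 6 * K * G with hC₀_def
  have hw₂le : ∀ t ∈ Icc (0 : ℝ) 1, w₂ t ≤ C₀ := by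
    intro t ht
    have h1 : deriv φ t ^ 2 ≤ (3 * K) ^ 2 := by
      have := pow_le_pow_left₀ (abs_nonneg _) (hφ'b t) 2
      rwa [sq_abs] at this
    have h2 : -(2 * φ t * deriv φ t * F₁ t) ≤ 2 * 1 * (3 * K) * G := by
      have habs : |2 * φ t * deriv φ t * F₁ t| ≤ 2 * 1 * (3 * K) * G := by
        have hφa := hφabs t
        have hφ'a := hφ'b t
        have hFa := hG t ht
        have hK0 : 0 ≤ 3 * K := (abs_nonneg _).trans hφ'a
        have e : |2 * φ t * deriv φ t * F₁ t| = 2 * (|φ t| * (|deriv φ t| * |F₁ t|)) := by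
          rw [abs_mul, abs_mul, abs_mul, abs_two]
          ring
        rw [e]
        have h3 : |deriv φ t| * |F₁ t| ≤ 3 * K * G := mul_le_mul hφ'a hFa (abs_nonneg _) hK0
        have h4 : |φ t| * (|deriv φ t| * |F₁ t|) ≤ 1 * (3 * K * G) :=
          mul_le_mul hφa h3 (by positivity) zero_le_one
        linarith
      exact (neg_le_abs _).trans habs
    have h4 : c * deriv φ t ^ 2 ≤ c * (3 * K) ^ 2 := mul_le_mul_of_nonneg_left h1 hc
    show c * deriv φ t ^ 2 - 2 * φ t * deriv φ t * F₁ t - 1 / 2 * φ t ^ 2 ≤ C₀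
    rw [hC₀_def]
    nlinarith [sq_nonneg (φ t)]
  have hw₂le' : ∀ t ∈ Icc (1 : ℝ) T, 1 < T → w₂ t ≤ 0 := by
    intro t ht hT1
    have hd : deriv φ t = 0 := hφ'0 t ht hT1
    show c * deriv φ t ^ 2 - 2 * φ t * deriv φ t * F₁ t - 1 / 2 * φ t ^ 2 ≤ 0
    rw [hd]
    nlinarith [sq_nonneg (φ t)]
  -- the integral bound
  have hI1 : ∫ t in (0 : ℝ)..1, w₂ t ≤ C₀ := by
    have h := intervalIntegral.integral_mono_on zero_le_one
      (hw₂c.intervalIntegrable (μ := volume) _ _)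
      (continuous_const.intervalIntegrable (μ := volume) _ _) hw₂le
    rwa [intervalIntegral.integral_const, sub_zero, one_smul] at h
  have hI2 : ∫ t in (1 : ℝ)..T, w₂ t ≤ 0 := by
    rcases eq_or_lt_of_le hT with hT1 | hT1
    · rw [← hT1, intervalIntegral.integral_same]
    · have h := intervalIntegral.integral_mono_on hT (hw₂c.intervalIntegrable (μ := volume) _ _)
        (continuous_const.intervalIntegrable (μ := volume) _ _) (fun t ht ↦ hw₂le' t ht hT1)
      rwa [intervalIntegral.integral_const, smul_zero] at h
  rw [hkey, ← intervalIntegral.integral_add_adjacent_intervals (b := 1)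
    (hw₂c.intervalIntegrable _ _) (hw₂c.intervalIntegrable _ _)]
  linarith

end Literature.Geometry.Riemannian.Zhang2009

end
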